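import Summits.CriticalPhenomena.PercolationContinuityZ3.Theorems.Transplant.SkelNegBParamsFaceFloorsTXA
import Summits.CriticalPhenomena.PercolationContinuityZ3.Theorems.Transplant.SkelNegBParamsFaceRunA
import Summits.CriticalPhenomena.PercolationContinuityZ3.Theorems.Transplant.SkelPhiFaceNumsYRun
import HarnessLib

/-!
# N1 params, M3 group G-Y part T — **THE x-FACE TANGENTIAL y′-RUN's TRANSVERSE FLOORS `FY5`/`FY6`** (fields `FloorsX2.FY5/FY6`, SkelPhiFaceNumsXP2 :64–:69) at
# M3-FLOORS-SIGNATURE §1 (`coarse c₁ (D/2) D (lam1 A n_L h_L yT) = KS.F1cA yT`, `κ₁ := u₁A`, `mod := m`, `qB₃ := qB3XA (RA′ mk)`, `R'₃ := RA′ mk`, `k₀ := 3`), SPLIT AS: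
# (level-box envelope, this file) region `k`'s transverse fine reading lies in `F1cA yT + τ·u₁·k ± (5u₁ + 1)` — **`ySLo_lb`/`ySHi_ub`**:
# `τ·k·m − Err ≤ U·ySLo τ k`, `U·ySHi τ k ≤ τ·k·m + Err`, `Err := 2kU + U·qB₃ + U(k+1)RA′ + 3n_Lℓ_L + U ≤ 5m − U` for `k + 1 ≤ 200·Kq + 10` under
# `22000·Kq·(RA′+2) ≤ ℓ_L`; hence **`FY5_XA`** from `hlo : −fw + 5u₁ + 1 ≤ F1cA yT + τ·u₁·k` and **`FY6_XA`** from `hhi : F1cA yT + τ·u₁·k + 5u₁ + 1 ≤ fw`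
# (`fw = 5r⊥ − 7 − |z⊥ − cen⊥|`); (run position, integrator) `hlo/hhi` for `k ≤ N3X` follow from `σTX/N3X_spec` (the run goes from `F1cA yL` towards `T1X`,
# `|F1cA yT − F1cA yL| ≤ 1`), `|F1cA yL| ≤ 3u₁`, `|T1X|, |z⊥−cen⊥| ≤ kE` and the band room `KS.hkE2_RA : 2kE + 8u₁ + 8 ≤ 5r⊥` (FaceBandRoomA).  (stmt-g16 2026-08-22.)
builds on p205010 (kernel theorem, internal audit signed; external expert review pending) — nothing in this file uses p205010; NOTHING is claimed about the node
`SamePDropOfSkeletonNeg₁` (OPEN); arithmetic only.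
Lane `prim-bschramm-*`, seat `prim-bschramm-stmt` (gen 16); helper file (`--supports stmt-CriticalPhenomena-4575 --as helper`); slot-ledger ζ′ v1.
[cite: KozmaNitzan2024, §4 Lemma 12 (pp. 23–25)] [cite: MartineauTassion2017, §4.1]
-/

noncomputable section

open scoped Classical

namespace Summit.CriticalPhenomena.PercolationContinuityZ3.Theorems.Transplant

namespace PlanarSkeletonNeg

namespace NegB

open Literature.Probability.Percolation Literature.Probability.LatticeModels SimpleGraph
open SkelConc (Consts)
open Skelφ (shearUnit shearUnit_pos yBoxLoS yBoxHiS ySLo ySHi)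
open Skelφ.StepI (DataN)
open TwoAxis.Para (modulus)
open Neg

namespace KS

section FloorsTY

variable (κ : Consts) {V : Type} [DecidableEq V] [Countable V] {G : SimpleGraph V} [G.LocallyFinite] (Φ : PlanarSkeletonNeg G) (t : V)
  (p : unitInterval) (D : DataN V) (g f mk : ℕ)

/-- The level boxes in terms of part RootValsY's `sLoY/sHiY/LaY`. [folklore] -/
theorem yBoxS_eq (q R' k : ℕ) :
    yBoxLoS (nL κ Φ t p D g f) (ℓL κ Φ t p D g f) (hL κ Φ t p D g f) q R' k = (k : ℤ) * sLoY κ Φ t p D g f - q - (k : ℤ) * R' - R' - (LaY κ Φ t p D g f : ℤ) ∧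
      yBoxHiS (nL κ Φ t p D g f) (ℓL κ Φ t p D g f) (hL κ Φ t p D g f) q R' k = (k : ℤ) * sHiY κ Φ t p D g f + q + (k : ℤ) * R' + R' + (LaY κ Φ t p D g f : ℤ) :=
  ⟨rfl, rfl⟩

/-- **The level-box envelope of region `k`** (`τ = ±1`): `τ·k·m − Err ≤ U·ySLo τ k` and `U·ySHi τ k ≤ τ·k·m + Err` with `Err := 2kU + U·q + U·(k+1)·R′ + 3n_Lℓ_L + U`.
[folklore] -/
theorem ySBox_env (hN : EqNumL κ Φ t p D g f) {τ : ℤ} (hτ : τ = 1 ∨ τ = -1) (q R' k : ℕ) :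
    τ * (k : ℤ) * modulus (nL κ Φ t p D g f) (hL κ Φ t p D g f) (vL κ Φ t p D g f) (vβL κ Φ t p D g f) -
        (2 * (k : ℤ) * (shearUnit (nL κ Φ t p D g f) (hL κ Φ t p D g f) : ℤ) + (shearUnit (nL κ Φ t p D g f) (hL κ Φ t p D g f) : ℤ) * q +
          (shearUnit (nL κ Φ t p D g f) (hL κ Φ t p D g f) : ℤ) * (((k : ℤ) + 1) * R') + 3 * ((nL κ Φ t p D g f : ℤ) * ℓL κ Φ t p D g f) + shearUnit (nL κ Φ t p D g f) (hL κ Φ t p D g f)) ≤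
      (shearUnit (nL κ Φ t p D g f) (hL κ Φ t p D g f) : ℤ) * ySLo (nL κ Φ t p D g f) (ℓL κ Φ t p D g f) (hL κ Φ t p D g f) q R' τ k ∧
    (shearUnit (nL κ Φ t p D g f) (hL κ Φ t p D g f) : ℤ) * ySHi (nL κ Φ t p D g f) (ℓL κ Φ t p D g f) (hL κ Φ t p D g f) q R' τ k ≤
      τ * (k : ℤ) * modulus (nL κ Φ t p D g f) (hL κ Φ t p D g f) (vL κ Φ t p D g f) (vβL κ Φ t p D g f) +
        (2 * (k : ℤ) * (shearUnit (nL κ Φ t p D g f) (hL κ Φ t p D g f) : ℤ) + (shearUnit (nL κ Φ t p D g f) (hL κ Φ t p D g f) : ℤ) * q +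
          (shearUnit (nL κ Φ t p D g f) (hL κ Φ t p D g f) : ℤ) * (((k : ℤ) + 1) * R') + 3 * ((nL κ Φ t p D g f : ℤ) * ℓL κ Φ t p D g f) + shearUnit (nL κ Φ t p D g f) (hL κ Φ t p D g f)) := by
  obtain ⟨hn1, hℓ1⟩ := one_le_of_eqNumL κ Φ t p D g f hN
  have hmm := Skelφ.NegPrm.modulus_vβOf hn1 (hL κ Φ t p D g f) (ℓL κ Φ t p D g f) (vL κ Φ t p D g f)
  have e : vβL κ Φ t p D g f = Skelφ.NegPrm.vβOf (nL κ Φ t p D g f) (hL κ Φ t p D g f) (ℓL κ Φ t p D g f) (vL κ Φ t p D g f) := rfl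
  rw [← e] at hmm
  obtain ⟨hm1, hm2⟩ := hmm
  obtain ⟨sL, sH, sH', sLa⟩ := sY_spec κ Φ t p D g f hn1
  have hUpos := shearUnit_pos hn1 (hL κ Φ t p D g f)
  have sLu : (shearUnit (nL κ Φ t p D g f) (hL κ Φ t p D g f) : ℤ) * sLoY κ Φ t p D g f ≤ (nL κ Φ t p D g f : ℤ) * ℓL κ Φ t p D g f - (shearUnit (nL κ Φ t p D g f) (hL κ Φ t p D g f) : ℤ) + 1 := by
    unfold sLoY; exact Int.mul_ediv_self_le hUpos.ne'
  obtain ⟨eLo, eHi⟩ := yBoxS_eq κ Φ t p D g f q R' k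
  have hUe : (shearUnit (nL κ Φ t p D g f) (hL κ Φ t p D g f) : ℤ) = (nL κ Φ t p D g f : ℤ) + ((hL κ Φ t p D g f).natAbs : ℤ) := by
    unfold Skelφ.shearUnit; push_cast; ring
  have hh0 : (0 : ℤ) ≤ ((hL κ Φ t p D g f).natAbs : ℤ) := Nat.cast_nonneg _
  have hn : (1 : ℤ) ≤ (nL κ Φ t p D g f : ℤ) := by exact_mod_cast hn1
  unfold Skelφ.ySLo Skelφ.ySHi
  rw [eLo, eHi]
  set U : ℤ := (shearUnit (nL κ Φ t p D g f) (hL κ Φ t p D g f) : ℤ)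
  set n : ℤ := (nL κ Φ t p D g f : ℤ)
  set ℓ : ℤ := (ℓL κ Φ t p D g f : ℤ)
  set m := modulus (nL κ Φ t p D g f) (hL κ Φ t p D g f) (vL κ Φ t p D g f) (vβL κ Φ t p D g f)
  set sl := sLoY κ Φ t p D g f
  set sh := sHiY κ Φ t p D g f
  set La : ℤ := (LaY κ Φ t p D g f : ℤ)
  have hUn : n ≤ U := by rw [hUe]; linarith
  have hk0 : (0 : ℤ) ≤ (k : ℤ) := Nat.cast_nonneg _
  have hq0 : (0 : ℤ) ≤ (q : ℤ) := Nat.cast_nonneg _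
  have hR0 : (0 : ℤ) ≤ (R' : ℤ) := Nat.cast_nonneg _
  have hLa0 : (0 : ℤ) ≤ La := Nat.cast_nonneg _
  have hU0 : 0 ≤ U := by linarith
  -- per-stride: `m − 2U ≤ U·sl`, `U·sh ≤ m + 2U` (`nℓ − U + 1 ≤ m ≤ nℓ`)
  have hsl : (k : ℤ) * (m - 2 * U) ≤ (k : ℤ) * (U * sl) := mul_le_mul_of_nonneg_left (by linarith) hk0
  have hsh : (k : ℤ) * (U * sh) ≤ (k : ℤ) * (m + 2 * U) := mul_le_mul_of_nonneg_left (by linarith) hk0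
  have hLoHi : (k : ℤ) * sl - (q : ℤ) - (k : ℤ) * R' - R' - La ≤ (k : ℤ) * sh + (q : ℤ) + (k : ℤ) * R' + R' + La := by
    have hslh : U * sl ≤ U * sh := by linarith
    have : sl ≤ sh := le_of_mul_le_mul_left hslh (by linarith)
    have : (k : ℤ) * sl ≤ (k : ℤ) * sh := mul_le_mul_of_nonneg_left this hk0
    nlinarith [mul_nonneg hk0 hR0]
  rcases hτ with rfl | rfl
  · simp only [one_mul]
    rw [min_eq_left hLoHi, max_eq_right hLoHi]
    constructor
    · have e1 : U * ((k : ℤ) * sl - (q : ℤ) - (k : ℤ) * R' - R' - La) = (k : ℤ) * (U * sl) - U * q - U * (((k : ℤ) + 1) * R') - U * La := by ring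
      rw [e1]; linarith
    · have e1 : U * ((k : ℤ) * sh + (q : ℤ) + (k : ℤ) * R' + R' + La) = (k : ℤ) * (U * sh) + U * q + U * (((k : ℤ) + 1) * R') + U * La := by ring
      rw [e1]; linarith
  · simp only [neg_mul, one_mul]
    rw [min_eq_right (neg_le_neg hLoHi), max_eq_left (neg_le_neg hLoHi)]
    constructor
    · have e1 : U * -((k : ℤ) * sh + (q : ℤ) + (k : ℤ) * R' + R' + La) = -((k : ℤ) * (U * sh) + U * q + U * (((k : ℤ) + 1) * R') + U * La) := by ring
      rw [e1]; linarith
    · have e1 : U * -((k : ℤ) * sl - (q : ℤ) - (k : ℤ) * R' - R' - La) = -((k : ℤ) * (U * sl)) + U * q + U * (((k : ℤ) + 1) * R') + U * La := by ring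
      rw [e1]; linarith

/-- **The envelope's size**: `Err + U ≤ 5·m` at `q := qB3XA (RA′)`, `R′ := RA′`, for `k + 1 ≤ 200·Kq + 10`, under `22000·Kq·(RA′+2) ≤ ℓ_L`, `|h_L| ≤ 10n_L`. [folklore] -/
theorem ySBox_err_le (hN : EqNumL κ Φ t p D g f) (hκ : (hL κ Φ t p D g f).natAbs ≤ 10 * nL κ Φ t p D g f)
    (hℓ : 22000 * Neg.Kq κ * (RA' κ Φ t p D mk + 2) ≤ ℓL κ Φ t p D g f) {k : ℕ} (hk : k + 1 ≤ 200 * Neg.Kq κ + 10) :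
    (2 * (k : ℤ) * (shearUnit (nL κ Φ t p D g f) (hL κ Φ t p D g f) : ℤ) + (shearUnit (nL κ Φ t p D g f) (hL κ Φ t p D g f) : ℤ) * (qB3XA κ Φ t p D g f (RA' κ Φ t p D mk) : ℕ) +
          (shearUnit (nL κ Φ t p D g f) (hL κ Φ t p D g f) : ℤ) * (((k : ℤ) + 1) * (RA' κ Φ t p D mk : ℕ)) + 3 * ((nL κ Φ t p D g f : ℤ) * ℓL κ Φ t p D g f) +
        shearUnit (nL κ Φ t p D g f) (hL κ Φ t p D g f)) + shearUnit (nL κ Φ t p D g f) (hL κ Φ t p D g f) ≤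
      5 * modulus (nL κ Φ t p D g f) (hL κ Φ t p D g f) (vL κ Φ t p D g f) (vβL κ Φ t p D g f) := by
  obtain ⟨hn1, hℓ1⟩ := one_le_of_eqNumL κ Φ t p D g f hN
  have hmm := Skelφ.NegPrm.modulus_vβOf hn1 (hL κ Φ t p D g f) (ℓL κ Φ t p D g f) (vL κ Φ t p D g f)
  have e : vβL κ Φ t p D g f = Skelφ.NegPrm.vβOf (nL κ Φ t p D g f) (hL κ Φ t p D g f) (ℓL κ Φ t p D g f) (vL κ Φ t p D g f) := rfl
  rw [← e] at hmm
  obtain ⟨hm1, hm2⟩ := hmm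
  obtain ⟨hW, -⟩ := Wrun_spec κ Φ t p D g f hn1
  have hUe : (shearUnit (nL κ Φ t p D g f) (hL κ Φ t p D g f) : ℤ) = (nL κ Φ t p D g f : ℤ) + ((hL κ Φ t p D g f).natAbs : ℤ) := by
    unfold Skelφ.shearUnit; push_cast; ring
  have h10 : (((hL κ Φ t p D g f).natAbs : ℕ) : ℤ) ≤ 10 * (nL κ Φ t p D g f : ℤ) := by exact_mod_cast hκ
  have hh0 : (0 : ℤ) ≤ ((hL κ Φ t p D g f).natAbs : ℤ) := Nat.cast_nonneg _
  have hℓ' : 22000 * (Neg.Kq κ : ℤ) * ((RA' κ Φ t p D mk : ℤ) + 2) ≤ (ℓL κ Φ t p D g f : ℤ) := by exact_mod_cast hℓ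
  have hk' : (k : ℤ) + 1 ≤ 200 * (Neg.Kq κ : ℤ) + 10 := by exact_mod_cast hk
  have hq3 : ((qB3XA κ Φ t p D g f (RA' κ Φ t p D mk) : ℕ) : ℤ) = (Wrun κ Φ t p D g f : ℤ) + 1000 * (Neg.Kq κ : ℤ) * (RA' κ Φ t p D mk : ℤ) + 2 := by
    unfold qB3XA; push_cast; ring
  clear hℓ hk hκ
  rw [hq3]
  have hn : (1 : ℤ) ≤ (nL κ Φ t p D g f : ℤ) := by exact_mod_cast hn1
  have hKq : (1 : ℤ) ≤ (Neg.Kq κ : ℤ) := by exact_mod_cast Neg.one_le_Kq κ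
  have hR0 : (0 : ℤ) ≤ (RA' κ Φ t p D mk : ℤ) := Nat.cast_nonneg _
  have hk0 : (0 : ℤ) ≤ (k : ℤ) := Nat.cast_nonneg _
  set U : ℤ := (shearUnit (nL κ Φ t p D g f) (hL κ Φ t p D g f) : ℤ)
  set n : ℤ := (nL κ Φ t p D g f : ℤ)
  set ℓ : ℤ := (ℓL κ Φ t p D g f : ℤ)
  set m := modulus (nL κ Φ t p D g f) (hL κ Φ t p D g f) (vL κ Φ t p D g f) (vβL κ Φ t p D g f)
  set Q : ℤ := (Neg.Kq κ : ℤ)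
  set R : ℤ := (RA' κ Φ t p D mk : ℤ)
  set W : ℤ := (Wrun κ Φ t p D g f : ℤ)
  have hU11 : U ≤ 11 * n := by rw [hUe]; linarith
  have hUn : n ≤ U := by rw [hUe]; linarith
  have hU0 : 0 ≤ U := by linarith
  have hQR : 0 ≤ Q * R := mul_nonneg (by linarith) hR0
  -- `U·(W + 1000QR + 2) ≤ nℓ + U + 11n·1000QR + 2U`, `2kU ≤ 22n·(200Q+9)`, `U(k+1)R ≤ 11n(200Q+10)R`
  have a1 : U * (1000 * Q * R) ≤ (11 * n) * (1000 * Q * R) := mul_le_mul_of_nonneg_right hU11 (mul_nonneg (by linarith) hR0)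
  have a2 : 2 * (k : ℤ) * U ≤ 2 * (200 * Q + 9) * (11 * n) := by nlinarith
  have a3 : U * (((k : ℤ) + 1) * R) ≤ (11 * n) * ((200 * Q + 10) * R) := mul_le_mul hU11 (mul_le_mul_of_nonneg_right hk' hR0) (mul_nonneg (by linarith) hR0) (by linarith)
  -- the ℓ floor: `n·(…) ≤ n·(ℓ − 1) < m`
  have key : n * (2 * (200 * Q + 9) * 11 + 11000 * Q * R + 11 * ((200 * Q + 10) * R) + 60) ≤ n * (ℓ - 1) := by
    refine mul_le_mul_of_nonneg_left ?_ (by linarith)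
    nlinarith
  nlinarith

/-- **`FY5` at the (ζ′) x-face tuple** (`k₀ := 3`): the lower transverse reading of tangential region `k` is above `−fw`, given the run-position fact `hlo`.
[cite: KozmaNitzan2024, §4 Lemma 12 (pp. 23–25)] -/
theorem FY5_XA (hN : EqNumL κ Φ t p D g f) (hκ : (hL κ Φ t p D g f).natAbs ≤ 10 * nL κ Φ t p D g f)
    (hℓ : 22000 * Neg.Kq κ * (RA' κ Φ t p D mk + 2) ≤ ℓL κ Φ t p D g f) (yT x z : Site 2) (i : Fin 2) {τ : ℤ} (hτ : τ = 1 ∨ τ = -1)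
    {k : ℕ} (hk : k + 1 ≤ 200 * Neg.Kq κ + 10)
    (hlo : -(5 * ((fcellsA κ Φ t p D g f).r i : ℤ) - 4 - 3 - |z i - (fcellsA κ Φ t p D g f).cen x i|) + 5 * u₁A κ Φ t p D g f + 1 ≤
      F1cA κ Φ t p D g f yT + τ * u₁A κ Φ t p D g f * (k : ℤ)) :
    modulus (nL κ Φ t p D g f) (hL κ Φ t p D g f) (vL κ Φ t p D g f) (vβL κ Φ t p D g f) *
        (-(5 * ((fcellsA κ Φ t p D g f).r i : ℤ) - 4 - 3 - |z i - (fcellsA κ Φ t p D g f).cen x i|) - F1cA κ Φ t p D g f yT) ≤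
      u₁A κ Φ t p D g f * ((shearUnit (nL κ Φ t p D g f) (hL κ Φ t p D g f) : ℤ) *
          (ySLo (nL κ Φ t p D g f) (ℓL κ Φ t p D g f) (hL κ Φ t p D g f) (qB3XA κ Φ t p D g f (RA' κ Φ t p D mk)) (RA' κ Φ t p D mk) τ k - 1)) -
        modulus (nL κ Φ t p D g f) (hL κ Φ t p D g f) (vL κ Φ t p D g f) (vβL κ Φ t p D g f) + 1 := by
  obtain ⟨hn1, hℓ1⟩ := one_le_of_eqNumL κ Φ t p D g f hN
  have hm0 : 0 < modulus (nL κ Φ t p D g f) (hL κ Φ t p D g f) (vL κ Φ t p D g f) (vβL κ Φ t p D g f) := Skelφ.NegPrm.modulus_vβOf_pos hn1 hℓ1 _ _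
  have hu : 1 ≤ u₁A κ Φ t p D g f := (units_eqA κ Φ t p D g f).2.2.2.2.2.2.2
  obtain ⟨hlb, -⟩ := ySBox_env κ Φ t p D g f hN hτ (qB3XA κ Φ t p D g f (RA' κ Φ t p D mk)) (RA' κ Φ t p D mk) k
  have herr := ySBox_err_le κ Φ t p D g f mk hN hκ hℓ hk
  clear hℓ hk hκ
  set m := modulus (nL κ Φ t p D g f) (hL κ Φ t p D g f) (vL κ Φ t p D g f) (vβL κ Φ t p D g f)
  set u := u₁A κ Φ t p D g f
  set U : ℤ := (shearUnit (nL κ Φ t p D g f) (hL κ Φ t p D g f) : ℤ)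
  set S := ySLo (nL κ Φ t p D g f) (ℓL κ Φ t p D g f) (hL κ Φ t p D g f) (qB3XA κ Φ t p D g f (RA' κ Φ t p D mk)) (RA' κ Φ t p D mk) τ k
  set Err := 2 * (k : ℤ) * U + U * (qB3XA κ Φ t p D g f (RA' κ Φ t p D mk) : ℕ) + U * (((k : ℤ) + 1) * (RA' κ Φ t p D mk : ℕ)) +
    3 * ((nL κ Φ t p D g f : ℤ) * ℓL κ Φ t p D g f) + U
  set F := F1cA κ Φ t p D g f yT
  set fw := 5 * ((fcellsA κ Φ t p D g f).r i : ℤ) - 4 - 3 - |z i - (fcellsA κ Φ t p D g f).cen x i|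
  -- `u·(U·S − U) ≥ u·(τkm − Err − U)`, `u·(Err + U) ≤ 5um`, `m·(fw + F + τuk) ≥ m·(5u + 1)`
  have h1 : u * (τ * (k : ℤ) * m - Err - U) ≤ u * (U * (S - 1)) := mul_le_mul_of_nonneg_left (by linarith) (by linarith)
  have h2 : u * (Err + U) ≤ u * (5 * m) := mul_le_mul_of_nonneg_left herr (by linarith)
  have h3 : m * (5 * u + 1) ≤ m * (fw + F + τ * u * (k : ℤ)) := mul_le_mul_of_nonneg_left (by linarith) hm0.le
  nlinarith

/-- **`FY6` at the (ζ′) x-face tuple** (`k₀ := 3`): the upper transverse reading of tangential region `k` is below `fw`, given the run-position fact `hhi`.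
[cite: KozmaNitzan2024, §4 Lemma 12 (pp. 23–25)] -/
theorem FY6_XA (hN : EqNumL κ Φ t p D g f) (hκ : (hL κ Φ t p D g f).natAbs ≤ 10 * nL κ Φ t p D g f)
    (hℓ : 22000 * Neg.Kq κ * (RA' κ Φ t p D mk + 2) ≤ ℓL κ Φ t p D g f) (yT x z : Site 2) (i : Fin 2) {τ : ℤ} (hτ : τ = 1 ∨ τ = -1)
    {k : ℕ} (hk : k + 1 ≤ 200 * Neg.Kq κ + 10)
    (hhi : F1cA κ Φ t p D g f yT + τ * u₁A κ Φ t p D g f * (k : ℤ) + 5 * u₁A κ Φ t p D g f + 1 ≤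
      5 * ((fcellsA κ Φ t p D g f).r i : ℤ) - 4 - 3 - |z i - (fcellsA κ Φ t p D g f).cen x i|) :
    modulus (nL κ Φ t p D g f) (hL κ Φ t p D g f) (vL κ Φ t p D g f) (vβL κ Φ t p D g f) * (F1cA κ Φ t p D g f yT + 1) +
        u₁A κ Φ t p D g f * ((shearUnit (nL κ Φ t p D g f) (hL κ Φ t p D g f) : ℤ) *
            ySHi (nL κ Φ t p D g f) (ℓL κ Φ t p D g f) (hL κ Φ t p D g f) (qB3XA κ Φ t p D g f (RA' κ Φ t p D mk)) (RA' κ Φ t p D mk) τ k +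
          shearUnit (nL κ Φ t p D g f) (hL κ Φ t p D g f) - 1) ≤
      modulus (nL κ Φ t p D g f) (hL κ Φ t p D g f) (vL κ Φ t p D g f) (vβL κ Φ t p D g f) *
        (5 * ((fcellsA κ Φ t p D g f).r i : ℤ) - 4 - 3 - |z i - (fcellsA κ Φ t p D g f).cen x i|) := by
  obtain ⟨hn1, hℓ1⟩ := one_le_of_eqNumL κ Φ t p D g f hN
  have hm0 : 0 < modulus (nL κ Φ t p D g f) (hL κ Φ t p D g f) (vL κ Φ t p D g f) (vβL κ Φ t p D g f) := Skelφ.NegPrm.modulus_vβOf_pos hn1 hℓ1 _ _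
  have hu : 1 ≤ u₁A κ Φ t p D g f := (units_eqA κ Φ t p D g f).2.2.2.2.2.2.2
  obtain ⟨-, hub⟩ := ySBox_env κ Φ t p D g f hN hτ (qB3XA κ Φ t p D g f (RA' κ Φ t p D mk)) (RA' κ Φ t p D mk) k
  have herr := ySBox_err_le κ Φ t p D g f mk hN hκ hℓ hk
  clear hℓ hk hκ
  set m := modulus (nL κ Φ t p D g f) (hL κ Φ t p D g f) (vL κ Φ t p D g f) (vβL κ Φ t p D g f)
  set u := u₁A κ Φ t p D g f
  set U : ℤ := (shearUnit (nL κ Φ t p D g f) (hL κ Φ t p D g f) : ℤ)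
  set S := ySHi (nL κ Φ t p D g f) (ℓL κ Φ t p D g f) (hL κ Φ t p D g f) (qB3XA κ Φ t p D g f (RA' κ Φ t p D mk)) (RA' κ Φ t p D mk) τ k
  set Err := 2 * (k : ℤ) * U + U * (qB3XA κ Φ t p D g f (RA' κ Φ t p D mk) : ℕ) + U * (((k : ℤ) + 1) * (RA' κ Φ t p D mk : ℕ)) +
    3 * ((nL κ Φ t p D g f : ℤ) * ℓL κ Φ t p D g f) + U
  set F := F1cA κ Φ t p D g f yT
  set fw := 5 * ((fcellsA κ Φ t p D g f).r i : ℤ) - 4 - 3 - |z i - (fcellsA κ Φ t p D g f).cen x i|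
  have h1 : u * (U * S + U - 1) ≤ u * (τ * (k : ℤ) * m + Err + U) := mul_le_mul_of_nonneg_left (by linarith) (by linarith)
  have h2 : u * (Err + U) ≤ u * (5 * m) := mul_le_mul_of_nonneg_left herr (by linarith)
  have h3 : m * (F + τ * u * (k : ℤ) + 5 * u + 1) ≤ m * fw := mul_le_mul_of_nonneg_left hhi hm0.le
  nlinarith

end FloorsTY

end KS

end NegB

end PlanarSkeletonNeg

end Summit.CriticalPhenomena.PercolationContinuityZ3.Theorems.Transplant

end
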